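import Summits.Ventures.GridStability.Models.DroopQVDeflation
import Summits.Ventures.GridStability.Models.DroopQVData

/-!
# GridStability/Models/DroopQVGainAffine — the droop+QV Jacobian is AFFINE in the P–f droop gains; PARAMETRIC (gain-box / gain-ray) certificates of the deflation lane

Cell `gridfusion` (LADDER-GRIDFUSION, APEX LINE rung G3.b; seat gridfusion-model-8 (g4); offered to lead g8 2026-08-27T18:3xZ as
«G3.b-ss-DROOPQV-…-GAINBOX-RATE», generic half). All point/rate certificates of the G3.b lane so far concern ONE parameter set. The lever typed
here: for model N1 (`DroopMicrogrid`, [cite: KunduEtAl2019, eqs. (4a)–(4c)]) the P–f droop gains `k_Pi` enter the field only through the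
frequency rows `ω̇_i = (−ω_i + k_Pi(P^set_i − P_i))/τ_Pi`, so
* §1 `withKP κ` (the same microgrid with gains `κ`) has the SAME flows, set-points and rest points (`withKP_isSteadyState_iff`,
  `withKP_field_eq_zero`), the same sensitivity blocks `Pθ, PV, Qθ, QV`, and its Jacobian is AFFINE in the gains:
  `jacMatrix (withKP (k_P + s·w)) (θ, V) = jacMatrix (θ, V) + s • jacSlope w (θ, V)` (`jacMatrix_withKP_add`), the slope
  `jacSlope w = [[0, 0, 0], [−diag(w/τ_P)·Pθ, 0, −diag(w/τ_P)·PV], [0, 0, 0]]` living in the FREQUENCY ROWS only;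
* §2 matrix algebra of AFFINE certificates: if the Lyapunov matrix is affine too, `S(s) = S₀ + s·S₁` with `S₁·J₁ = 0` (e.g. `S₁` supported on the
  angle/voltage block — the natural scaling of the potential part of an energy function with the synchronising stiffness), then the certificate matrix
  `H(s) = S(s)(−J(s)) + (S(s)(−J(s)))ᵀ − c·S(s)` is AFFINE in `s` (`lyapCert_affine`); a symmetric affine pencil is positive definite on a SEGMENT as soon
  as it is at the two endpoints (`posDef_affine_of_endpoints`, convexity = quadratic stability of a polytopic family) and on a RAY as soon as it is at the
  base point with a positive SEMIdefinite slope (`posDef_affine_of_posSemidef_slope`);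
* §3 the packaged PARAMETRIC deflation lane `eig_re_lt_neg_of_deflate_withKP`: the point-lane theorem `eig_re_lt_neg_of_deflate` (p530169) read for
  the model `withKP κ` — its hypotheses are the two PSD facts AT THE PARAMETER, which instance files discharge on whole gain intervals by §2 from
  finitely many integer Gram certificates.
THREE COLUMNS. CERTIFIED (kernel): algebra/calculus identities about the MODEL N1 (MV-6N) and linear algebra; no numbers, no instance. The
quadratic-stability-on-a-polytope principle behind §2 is textbook LMI material (common / affinely parameter-dependent quadratic Lyapunov functions);
here it is proved from scratch in three lines, so no fact is cited for it. No sentence of this file says a converter or a microgrid is stable.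
-/

noncomputable section

open Real Matrix Finset
open scoped ComplexOrder

namespace Summit.Ventures.GridStability.Models

/-! ## §2 Affine certificate algebra (stated first; pure linear algebra) -/

section Affine

variable {ι : Type*}

/-- **Affine Lyapunov pencil.** If `S₁·J₁ = 0` then
`(S₀ + s·S₁)(−(J₀ + s·J₁)) + ((S₀ + s·S₁)(−(J₀ + s·J₁)))ᵀ − c·(S₀ + s·S₁) = H₀ + s·H₁` with
`H₀ = S₀(−J₀) + (S₀(−J₀))ᵀ − c·S₀` and `H₁ = −(S₀J₁ + S₁J₀) − (S₀J₁ + S₁J₀)ᵀ − c·S₁` (the `s²` term is `S₁J₁ = 0`). [folklore] -/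
theorem lyapCert_affine [Fintype ι] (S₀ S₁ J₀ J₁ : Matrix ι ι ℝ) (c s : ℝ) (h : S₁ * J₁ = 0) :
    (S₀ + s • S₁) * (-(J₀ + s • J₁)) + ((S₀ + s • S₁) * (-(J₀ + s • J₁)))ᵀ - c • (S₀ + s • S₁)
      = (S₀ * (-J₀) + (S₀ * (-J₀))ᵀ - c • S₀) + s • (-(S₀ * J₁ + S₁ * J₀) - (S₀ * J₁ + S₁ * J₀)ᵀ - c • S₁) := by
  simp only [Matrix.mul_neg, Matrix.add_mul, Matrix.mul_add, Matrix.smul_mul, Matrix.mul_smul, h, smul_zero, add_zero,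
    Matrix.transpose_add, Matrix.transpose_neg, Matrix.transpose_smul, neg_add, smul_add, smul_neg,
    sub_eq_add_neg, smul_smul, mul_comm c s]
  abel

/-- **Positive definiteness along a segment**: a symmetric affine pencil `M₀ + s·M₁` that is positive definite at `s = a` and at `s = b` is positive
definite for every `a ≤ s ≤ b` (convex combination). [folklore] -/
theorem posDef_affine_of_endpoints {M₀ M₁ : Matrix ι ι ℝ} {a b s : ℝ} (ha : (M₀ + a • M₁).PosDef) (hb : (M₀ + b • M₁).PosDef)
    (has : a ≤ s) (hsb : s ≤ b) : (M₀ + s • M₁).PosDef := by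
  rcases eq_or_lt_of_le has with rfl | has'
  · exact ha
  have hab : 0 < b - a := by linarith
  have key : M₀ + s • M₁ = ((b - s) / (b - a)) • (M₀ + a • M₁) + ((s - a) / (b - a)) • (M₀ + b • M₁) := by
    ext i j
    simp only [Matrix.add_apply, Matrix.smul_apply, smul_eq_mul]
    field_simp
    ring
  rw [key]
  exact Matrix.PosDef.posSemidef_add (ha.posSemidef.smul (div_nonneg (by linarith) hab.le)) (hb.smul (div_pos (by linarith) hab))

/-- **Positive definiteness along a ray**: `M₀ + a·M₁ ≻ 0` and `M₁ ⪰ 0` give `M₀ + s·M₁ ≻ 0` for every `s ≥ a`. [folklore] -/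
theorem posDef_affine_of_posSemidef_slope {M₀ M₁ : Matrix ι ι ℝ} {a s : ℝ} (ha : (M₀ + a • M₁).PosDef) (h₁ : M₁.PosSemidef)
    (has : a ≤ s) : (M₀ + s • M₁).PosDef := by
  have key : M₀ + s • M₁ = (M₀ + a • M₁) + (s - a) • M₁ := by
    rw [sub_smul, add_assoc, add_sub_cancel]
  rw [key]
  exact ha.add_posSemidef (h₁.smul (by linarith))

/-- Cast plumbing for affine pencils of rational literals: `(X + q·Y).map = X.map + q·Y.map`. [folklore] -/
theorem map_ratCast_add_smul (X Y : Matrix ι ι ℚ) (q : ℚ) :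
    (X + q • Y).map ((↑) : ℚ → ℝ) = X.map ((↑) : ℚ → ℝ) + (q : ℝ) • Y.map ((↑) : ℚ → ℝ) := by
  ext i j
  simp only [Matrix.map_apply, Matrix.add_apply, Matrix.smul_apply, smul_eq_mul]
  push_cast
  ring

/-- Cast plumbing: the certificate expression commutes with `ℚ → ℝ`. [folklore] -/
theorem map_ratCast_lyapCert [Fintype ι] (S J : Matrix ι ι ℚ) (c : ℚ) :
    (S * (-J) + (S * (-J))ᵀ - c • S).map ((↑) : ℚ → ℝ)
      = S.map ((↑) : ℚ → ℝ) * (-J.map ((↑) : ℚ → ℝ)) + (S.map ((↑) : ℚ → ℝ) * (-J.map ((↑) : ℚ → ℝ)))ᵀ - (c : ℝ) • S.map ((↑) : ℚ → ℝ) := by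
  ext i j
  simp only [Matrix.map_apply, Matrix.sub_apply, Matrix.add_apply, Matrix.mul_apply, Matrix.transpose_apply, Matrix.smul_apply,
    Matrix.neg_apply, smul_eq_mul]
  push_cast
  rfl

/-- Cast plumbing: products of rational literals. [folklore] -/
theorem map_ratCast_mul {κ : Type*} [Fintype κ] (X : Matrix ι κ ℚ) (Y : Matrix κ ι ℚ) :
    (X * Y).map ((↑) : ℚ → ℝ) = X.map ((↑) : ℚ → ℝ) * Y.map ((↑) : ℚ → ℝ) := by
  have hf : ((↑) : ℚ → ℝ) = Rat.castHom ℝ := rfl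
  rw [hf, Matrix.map_mul]

/-- Reindexing plumbing: the certificate expression commutes with `submatrix e e` for an equivalence `e`. [folklore] -/
theorem lyapCert_submatrix [Fintype ι] {N : ℕ} (e : ι ≃ Fin N) (S J : Matrix (Fin N) (Fin N) ℝ) (c : ℝ) :
    S.submatrix e e * (-J.submatrix e e) + (S.submatrix e e * (-J.submatrix e e))ᵀ - c • S.submatrix e e
      = (S * (-J) + (S * (-J))ᵀ - c • S).submatrix e e := by
  ext a b
  simp only [Matrix.sub_apply, Matrix.add_apply, Matrix.mul_apply, Matrix.transpose_apply, Matrix.smul_apply, Matrix.neg_apply,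
    Matrix.submatrix_apply]
  rw [e.sum_comp (fun k => S (e a) k * -J k (e b)), e.sum_comp (fun k => S (e b) k * -J k (e a))]

end Affine

/-! ## §1 The model with other P–f droop gains; the Jacobian is affine in the gains -/

namespace DroopMicrogrid

variable {n : ℕ} (mg : DroopMicrogrid n)

/-- **The same droop microgrid with P–f droop gains `κ`** (all other data — filter constants, Q–V gains, set-points, nominal voltages, network —
unchanged). [cite: KunduEtAl2019, eq. (4b)] -/
def withKP (κ : Fin n → ℝ) : DroopMicrogrid n := { mg with kP := κ }

variable (κ : Fin n → ℝ)

/-- Gains of `withKP κ`. [folklore] -/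
@[simp] theorem withKP_kP : (mg.withKP κ).kP = κ := rfl
/-- Unchanged data of `withKP κ`. [folklore] -/
@[simp] theorem withKP_τP : (mg.withKP κ).τP = mg.τP := rfl
/-- Unchanged data of `withKP κ`. [folklore] -/
@[simp] theorem withKP_τQ : (mg.withKP κ).τQ = mg.τQ := rfl
/-- Unchanged data of `withKP κ`. [folklore] -/
@[simp] theorem withKP_kQ : (mg.withKP κ).kQ = mg.kQ := rfl
/-- Unchanged data of `withKP κ`. [folklore] -/
@[simp] theorem withKP_Vset : (mg.withKP κ).Vset = mg.Vset := rfl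
/-- Unchanged data of `withKP κ`. [folklore] -/
@[simp] theorem withKP_Pset : (mg.withKP κ).Pset = mg.Pset := rfl
/-- Unchanged data of `withKP κ`. [folklore] -/
@[simp] theorem withKP_Qset : (mg.withKP κ).Qset = mg.Qset := rfl
/-- The flows do not read the gains. [folklore] -/
@[simp] theorem withKP_P : (mg.withKP κ).P = mg.P := rfl
/-- The flows do not read the gains. [folklore] -/
@[simp] theorem withKP_Q : (mg.withKP κ).Q = mg.Q := rfl
/-- The sensitivity blocks do not read the gains. [folklore] -/
@[simp] theorem withKP_Pθ : (mg.withKP κ).Pθ = mg.Pθ := rfl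
/-- The sensitivity blocks do not read the gains. [folklore] -/
@[simp] theorem withKP_PV : (mg.withKP κ).PV = mg.PV := rfl
/-- The sensitivity blocks do not read the gains. [folklore] -/
@[simp] theorem withKP_Qθ : (mg.withKP κ).Qθ = mg.Qθ := rfl
/-- The sensitivity blocks do not read the gains. [folklore] -/
@[simp] theorem withKP_QV : (mg.withKP κ).QV = mg.QV := rfl
/-- Voltage-row gains unchanged. [folklore] -/
@[simp] theorem withKP_ΛQ : (mg.withKP κ).ΛQ = mg.ΛQ := rfl
/-- Frequency-row gains of `withKP κ`: `κ_i/τ_Pi`. [folklore] -/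
@[simp] theorem withKP_ΛP (i : Fin n) : (mg.withKP κ).ΛP i = κ i / mg.τP i := rfl

/-- **The steady states do not depend on the P–f gains** (they read flows, set-points and nominal voltages only). [cite: KunduEtAl2019, after (5b)] -/
theorem withKP_isSteadyState_iff (θs : Fin n → ℝ) : (mg.withKP κ).IsSteadyState θs ↔ mg.IsSteadyState θs := Iff.rfl

/-- **The rest point does not move with the gains**: at a steady state of `mg` the field of `withKP κ` vanishes too. [folklore] -/
theorem withKP_field_eq_zero {θs : Fin n → ℝ} (h : mg.IsSteadyState θs) : (mg.withKP κ).field (θs, 0, mg.Vset) = 0 :=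
  (mg.withKP κ).field_eq_zero_of_isSteadyState ((mg.withKP_isSteadyState_iff κ θs).2 h)

/-- **The gain slope of the Jacobian in the direction `w` of gain space**, at a state `(θ, V)`:
`[[0, 0, 0], [−diag(w/τ_P)·Pθ, 0, −diag(w/τ_P)·PV], [0, 0, 0]]` — frequency rows only. [folklore] -/
def jacSlope (w : Fin n → ℝ) (θ V : Fin n → ℝ) : Matrix (Fin n ⊕ (Fin n ⊕ Fin n)) (Fin n ⊕ (Fin n ⊕ Fin n)) ℝ :=
  Matrix.fromBlocks 0 0
    (Matrix.fromRows (-(Matrix.diagonal (fun i => w i / mg.τP i) * mg.Pθ θ V)) 0)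
    (Matrix.fromBlocks 0 (-(Matrix.diagonal (fun i => w i / mg.τP i) * mg.PV θ V)) 0 0)

/-- **The Jacobian is AFFINE in the P–f droop gains**: moving the gains from `k_P` to `k_P + s·w` adds `s • jacSlope w` (at every state). [folklore] -/
theorem jacMatrix_withKP_add (w : Fin n → ℝ) (s : ℝ) (θ V : Fin n → ℝ) :
    (mg.withKP (fun i => mg.kP i + s * w i)).jacMatrix θ V = mg.jacMatrix θ V + s • mg.jacSlope w θ V := by
  ext a b
  rcases a with i | i | i <;> rcases b with j | j | j <;>
    simp [DroopMicrogrid.jacMatrix, jacSlope, DroopMicrogrid.ΛP, Matrix.fromBlocks, Matrix.fromRows,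
      Matrix.fromCols, Matrix.diagonal_mul, Matrix.add_apply, Matrix.neg_apply] <;>
    ring

/-- The slope kills the rotation vector (`Pθ 1 = 0`). [folklore] -/
theorem jacSlope_mulVec_rot (w : Fin n → ℝ) (θ V : Fin n → ℝ) : mg.jacSlope w θ V *ᵥ rot = 0 := by
  have h := mg.Pθ_mulVec_one θ V
  funext a
  rcases a with i | i | i
  · simp [jacSlope, rot, Matrix.mulVec, dotProduct, Matrix.fromBlocks, Fintype.sum_sum_type]
  · have hi := congr_fun h i
    simp only [Matrix.mulVec, dotProduct, Pi.zero_apply, mul_one] at hi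
    simp [jacSlope, rot, Matrix.mulVec, dotProduct, Matrix.fromBlocks, Matrix.fromRows, Fintype.sum_sum_type, Matrix.diagonal_mul,
      ← Finset.mul_sum, hi]
  · simp [jacSlope, rot, Matrix.mulVec, dotProduct, Matrix.fromBlocks, Fintype.sum_sum_type]

/-! ## §3 The parametric deflation lane -/

/-- **Deflation lane for the model with gains `κ`** — `eig_re_lt_neg_of_deflate` (p530169) read for `withKP κ`: data `ζ` with `Σ ζ_k r_k < −r₀ < 0`,
a Lyapunov matrix `S ≻ 0` (it may depend on `κ`) with `S(−J′) + (S(−J′))ᵀ − 2r₀S ≻ 0` for the deflated Jacobian `J′` OF `withKP κ`; then every complex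
eigenpair of `jacMatrix (withKP κ) (θ, V)` is the rotation mode or has `Re z < −r₀`. Instance files discharge the two PSD facts for ALL `κ` in a box from
finitely many certificates via §2. CERTIFIED (matrix statement about MODEL N1, MV-6N); no instance. [folklore] -/
theorem eig_re_lt_neg_of_deflate_withKP (θ V : Fin n → ℝ) (ζ : Fin n ⊕ (Fin n ⊕ Fin n) → ℝ) {r₀ : ℝ} (hr₀ : 0 < r₀)
    (hγ : ∑ k, ζ k * rot k < -r₀) {S : Matrix (Fin n ⊕ (Fin n ⊕ Fin n)) (Fin n ⊕ (Fin n ⊕ Fin n)) ℝ} (hS : S.PosDef)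
    (hH : (S * (-(mg.withKP κ).jacDefl θ V ζ) + (S * (-(mg.withKP κ).jacDefl θ V ζ))ᵀ - (2 * r₀) • S).PosDef)
    {z : ℂ} {v : Fin n ⊕ (Fin n ⊕ Fin n) → ℂ} (hv : v ≠ 0)
    (hJv : ((mg.withKP κ).jacMatrix θ V).map ((↑) : ℝ → ℂ) *ᵥ v = z • v) :
    (z = 0 ∧ ∃ a : ℂ, v = fun k => a * (rot k : ℂ)) ∨ z.re < -r₀ :=
  (mg.withKP κ).eig_re_lt_neg_of_deflate θ V ζ hr₀ hγ hS hH hv hJv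

/-- **No Jordan chain at the rotation zero, parametric version** (`no_jordan_chain_at_zero_of_deflate` for `withKP κ`). [folklore] -/
theorem no_jordan_chain_at_zero_of_deflate_withKP (θ V : Fin n → ℝ) (ζ : Fin n ⊕ (Fin n ⊕ Fin n) → ℝ) {r₀ : ℝ} (hr₀ : 0 < r₀)
    (hγ : ∑ k, ζ k * rot k < -r₀) {S : Matrix (Fin n ⊕ (Fin n ⊕ Fin n)) (Fin n ⊕ (Fin n ⊕ Fin n)) ℝ} (hS : S.PosDef)
    (hH : (S * (-(mg.withKP κ).jacDefl θ V ζ) + (S * (-(mg.withKP κ).jacDefl θ V ζ))ᵀ - (2 * r₀) • S).PosDef)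
    {w : Fin n ⊕ (Fin n ⊕ Fin n) → ℂ}
    (hw : ((mg.withKP κ).jacMatrix θ V).map ((↑) : ℝ → ℂ) *ᵥ w = fun k => ((rot k : ℝ) : ℂ)) : False :=
  (mg.withKP κ).no_jordan_chain_at_zero_of_deflate θ V ζ hr₀ hγ hS hH hw

/-- **The deflated Jacobian is affine in the gains too** (the deflation `r ζᵀ` does not read them). [folklore] -/
theorem jacDefl_withKP_add (w : Fin n → ℝ) (s : ℝ) (θ V : Fin n → ℝ) (ζ : Fin n ⊕ (Fin n ⊕ Fin n) → ℝ) :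
    (mg.withKP (fun i => mg.kP i + s * w i)).jacDefl θ V ζ = mg.jacDefl θ V ζ + s • mg.jacSlope w θ V := by
  rw [DroopMicrogrid.jacDefl, DroopMicrogrid.jacDefl, jacMatrix_withKP_add, add_right_comm]

end DroopMicrogrid

/-! ## §4 The ℚ-twin of the gain slope at the operating point of a `DroopQVData` instance -/

namespace DroopQVData

variable {n : ℕ} (d : DroopQVData n)

/-- ℚ-twin of `jacSlope 1 (θ*, V*)` (uniform direction `w = 1`): frequency rows `−diag(1/τ_P)·PθQ` and `−diag(1/τ_P)·PVQ`. [folklore] -/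
def jacSlopeQ : Matrix (Fin (n + 1) ⊕ (Fin (n + 1) ⊕ Fin (n + 1))) (Fin (n + 1) ⊕ (Fin (n + 1) ⊕ Fin (n + 1))) ℚ :=
  Matrix.fromBlocks 0 0
    (Matrix.fromRows (-(Matrix.diagonal (fun i => 1 / d.τP i) * d.PθQ)) 0)
    (Matrix.fromBlocks 0 (-(Matrix.diagonal (fun i => 1 / d.τP i) * d.PVQ)) 0 0)

/-- **Bridge for the slope**: `jacSlope 1 (θ*, V*)` of the instance model IS `jacSlopeQ` cast. [folklore] -/
theorem jacSlope_eq (hcirc : ∀ i, d.s i ^ 2 + d.c i ^ 2 = 1) :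
    d.toMicrogrid.jacSlope (fun _ => (1 : ℝ)) d.angleOf d.Vstar = d.jacSlopeQ.map ((↑) : ℚ → ℝ) := by
  have hg := fun i => d.toMicrogrid_gains i
  rw [DroopMicrogrid.jacSlope, d.Pθ_eq hcirc, d.PV_eq hcirc, jacSlopeQ]
  ext (i | i | i) (j | j | j) <;>
    simp [Matrix.fromBlocks, Matrix.fromRows, Matrix.mul_apply, Matrix.diagonal_apply, (hg i).1]

/-- The gains of the instance model are the rational data (cast). [folklore] -/
theorem toMicrogrid_kP (i : Fin (n + 1)) : d.toMicrogrid.kP i = (d.kP i : ℝ) := rfl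

end DroopQVData

end Summit.Ventures.GridStability.Models

end
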